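import Summits.ValiantsHypothesis.ValiantsHypothesis.Theses.MonotoneRestoration
import Summits.ValiantsHypothesis.ValiantsHypothesis.Theorems.MonotoneRestorationMonotoneRestorationQPEpsilonComplex

/-!
# MonotoneRestoration, support item `OrbitCut` (stmt-ValiantsHypothesis-18297) — PROVED

Route `MonotoneRestoration` of `ValiantsHypothesis`, support item `OrbitCut`: the GLUE OF THE ORBIT
CUT, `OrbitRestorationQP → OrbitCompressionQP → MonotoneRestorationQP` — one line from the route's
THEOREM ε `monotoneRestorationQP_iff_complexRestorationQP`
(`Theorems/MonotoneRestorationMonotoneRestorationQPEpsilonComplex.lean`), exactly as the planner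
recorded it. Honest framing: bookkeeping on a dormant route; VP ≠ VNP is NOT proved.
-/

noncomputable section

-- the summit and the problem share the name `ValiantsHypothesis` (D-0017 single-conjunct layout)
set_option linter.dupNamespace false

namespace Summit.ValiantsHypothesis.ValiantsHypothesis.Theorems.MonotoneRestoration

open Summit.ValiantsHypothesis.ValiantsHypothesis.Theses.MonotoneRestoration

/-- **`OrbitCut` (stmt-ValiantsHypothesis-18297):** `OrbitRestorationQP → OrbitCompressionQP →
MonotoneRestorationQP`, by the complex form of `MonotoneRestorationQP`
(`monotoneRestorationQP_iff_complexRestorationQP`). -/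
theorem orbitCut_proof :
    Summit.ValiantsHypothesis.ValiantsHypothesis.Theses.MonotoneRestoration.OrbitCut :=
  fun h₁ h₂ => monotoneRestorationQP_iff_complexRestorationQP.mpr fun f hs hVP => h₂ f hs hVP (h₁ f hs hVP)

end Summit.ValiantsHypothesis.ValiantsHypothesis.Theorems.MonotoneRestoration
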